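import Summits.NavierStokesRegularity.NavierStokesRegularity.Theorems.LerayQuarterDissipationFiniteDissipationLiouvilleEnvelope
import Summits.NavierStokesRegularity.NavierStokesRegularity.Theorems.ChiralWindowDoorClassDerivDecay
import Literature.Analysis.FluidPDE.PineauVicolOneSliceSmallDissipation
import HarnessLib

/-!
# Crux `FiniteDissipationLiouville` (stmt-NavierStokesRegularity-22144): the critical element's
# ALL-ORDERS SCALE-INVARIANT PACKAGE and the TIGHTNESS of its dissipation in similarity variables

Theorems file of route `LerayQuarterDissipation` (seat ns-lqd-p2 g7; `--supports` the crux).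
Navier–Stokes regularity is NOT proved by anything here; no summit is.

By `Envelope.envelope_of_minimal` (p612818) every critical element (singular member of `𝒟_{C,K_c}`,
`K_c` minimal) carries the space–time envelope `HasTypeIDecay A`. The tree's class calculus for the
envelope class (`ChiralWindowDoorClassDerivDecay.exists_classical_scaleInvariantBounds_of_class`,
KNSS Prop. 4.1 bootstrap + Riesz pressure) then hands it the full package:

* `scaleInvariantBounds_of_minimal` — every critical element `W` is classical on `(−∞,0)` with a
  pressure `Q` obeying `RellichScarScarRigidity.ScaleInvariantBounds W Q`: for every `n`,
  `‖∇ⁿW(t,x)‖ ≤ L_n/(‖x‖+√(−t))^{1+n}`, `‖∇ⁿQ‖ ≤ L_n/(‖x‖+√(−t))^{2+n}`,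
  `‖∂ₜ∇ⁿW‖ ≤ L_n/(‖x‖+√(−t))^{3+n}` — the critical element is a full self-similar-type profile;
* `dissipation_tail_of_minimal` — **tightness in similarity variables**: for every critical element
  there is `K_g` with `∫_{‖x‖ ≥ R√(−t)} ‖∇W(t)‖² ≤ K_g/(R√(−t))` for all `t < 0`, `R > 0`; i.e. the
  dimensionless dissipation outside the core `B(0, R√(−t))` is `≤ K_g/R → 0` UNIFORMLY IN TIME
  (the order-1 bound squared is `≤ L₁²‖x‖⁻⁴`, and `∫_{‖x‖≥a} ‖x‖⁻⁴ = a⁻¹ ∫_{‖η‖≥1} ‖η‖⁻⁴`,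
  `lintegral_norm_rpow_neg_four_ge_le`). Together with ns-lqd-p1's near-saturation
  (`CriticalElement.dissipation_nearMax_of_minimal`), the critical element's dissipation lives in
  the core, at the critical level, on a relatively dense set of log-times;
* `exists_criticalElement_scaleInvariantBounds` — packaged with `exists_minimal_singular`.

References: Koch–Nadirashvili–Seregin–Šverák 2009, Prop. 4.1; Chae–Wolf 2017, Thm. 1.1;
Pineau–Vicol 2026, §9 (the tail weight).
-/

noncomputable section

-- the summit and its single sub-problem share the name (CONVENTIONS §1), as in every Theorems file
set_option linter.dupNamespace false

namespace Summit.NavierStokesRegularity.NavierStokesRegularity.Theorems.FiniteDissipationLiouville.Envelope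

open MeasureTheory Set Filter Topology Metric Function
open Literature.Analysis Literature.Analysis.FluidPDE
open Summit.NavierStokesRegularity.NavierStokesRegularity.Theorems.FiniteDissipationLiouville
open Summit.NavierStokesRegularity.NavierStokesRegularity.Theorems
open scoped ENNReal NNReal

/-- **The critical element is a full scale-invariant profile.** If `K_c` is minimal for `C`, every
member of `𝒟_{C,K_c}` singular at the apex is classical on `(−∞,0)` with a pressure `Q` such that
`ScaleInvariantBounds W Q` holds (all spatial derivatives of `W`, `Q` and of `∂ₜW` with the
scale-invariant weights). [cite: KochNadirashviliSereginSverak2009, Prop. 4.1 (arXiv:0709.3599 p. 8)] -/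
theorem scaleInvariantBounds_of_minimal {C Kc : ℝ}
    (hmin : ∀ K' : ℝ, K' < Kc → ∀ w : ℝ → EuclideanSpace ℝ (Fin 3) → EuclideanSpace ℝ (Fin 3),
      IsTypeIAncientMild C w →
      (∀ s : ℝ, s < 0 → ∫⁻ x, ‖fderiv ℝ (w s) x‖ₑ ^ 2 ≤ ENNReal.ofReal (K' / Real.sqrt (-s))) →
      ¬ (∀ r > 0, ∀ M : ℝ, ∃ t ∈ Ioo (-(r ^ 2)) (0 : ℝ),
        ∃ x ∈ ball (0 : EuclideanSpace ℝ (Fin 3)) r, M < ‖w t x‖))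
    {W : ℝ → EuclideanSpace ℝ (Fin 3) → EuclideanSpace ℝ (Fin 3)} (hW : IsTypeIAncientMild C W)
    (hlaw : ∀ s : ℝ, s < 0 → ∫⁻ x, ‖fderiv ℝ (W s) x‖ₑ ^ 2 ≤ ENNReal.ofReal (Kc / Real.sqrt (-s)))
    (hsing : ∀ r > 0, ∀ M : ℝ, ∃ t ∈ Ioo (-(r ^ 2)) (0 : ℝ),
      ∃ x ∈ ball (0 : EuclideanSpace ℝ (Fin 3)) r, M < ‖W t x‖) :
    ∃ Q : ℝ → EuclideanSpace ℝ (Fin 3) → ℝ, IsClassicalNSSolutionOn (Iio (0 : ℝ)) 1 0 W Q ∧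
      RellichScarScarRigidity.ScaleInvariantBounds W Q := by
  obtain ⟨A, -, henv⟩ := envelope_of_minimal hmin
  exact ChiralWindowDoorClassDerivDecay.exists_classical_scaleInvariantBounds_of_class
    hW.hasTypeITimeDecay (henv W hW hlaw hsing) hW.continuousOn_uncurry
    (fun s t hst ht x => hW.mild_eq_heatExtension hst ht x) (fun t ht => hW.isDivFree ht)

/-- **Tightness of the dissipation of the critical element in similarity variables.** For every
critical element `W` there is `K_g` with `∫_{‖x‖ ≥ R√(−t)} ‖∇W(t)‖² ≤ K_g/(R√(−t))` for all
`t < 0`, `R > 0`: the dimensionless dissipation outside the core ball `B(0, R√(−t))` is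
`≤ K_g/R`, uniformly in time (order-1 scale-invariant bound + the tail weight
`∫_{‖x‖≥a} ‖x‖⁻⁴ ≤ a⁻¹ ∫_{‖η‖≥1} ‖η‖⁻⁴`). [cite: KochNadirashviliSereginSverak2009, Prop. 4.1 (arXiv:0709.3599 p. 8)] -/
theorem dissipation_tail_of_minimal {C Kc : ℝ}
    (hmin : ∀ K' : ℝ, K' < Kc → ∀ w : ℝ → EuclideanSpace ℝ (Fin 3) → EuclideanSpace ℝ (Fin 3),
      IsTypeIAncientMild C w →
      (∀ s : ℝ, s < 0 → ∫⁻ x, ‖fderiv ℝ (w s) x‖ₑ ^ 2 ≤ ENNReal.ofReal (K' / Real.sqrt (-s))) →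
      ¬ (∀ r > 0, ∀ M : ℝ, ∃ t ∈ Ioo (-(r ^ 2)) (0 : ℝ),
        ∃ x ∈ ball (0 : EuclideanSpace ℝ (Fin 3)) r, M < ‖w t x‖))
    {W : ℝ → EuclideanSpace ℝ (Fin 3) → EuclideanSpace ℝ (Fin 3)} (hW : IsTypeIAncientMild C W)
    (hlaw : ∀ s : ℝ, s < 0 → ∫⁻ x, ‖fderiv ℝ (W s) x‖ₑ ^ 2 ≤ ENNReal.ofReal (Kc / Real.sqrt (-s)))
    (hsing : ∀ r > 0, ∀ M : ℝ, ∃ t ∈ Ioo (-(r ^ 2)) (0 : ℝ),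
      ∃ x ∈ ball (0 : EuclideanSpace ℝ (Fin 3)) r, M < ‖W t x‖) :
    ∃ Kg : ℝ, 0 ≤ Kg ∧ ∀ t < 0, ∀ R > 0,
      ∫⁻ x in {x : EuclideanSpace ℝ (Fin 3) | R * Real.sqrt (-t) ≤ ‖x‖}, ‖fderiv ℝ (W t) x‖ₑ ^ 2 ≤
        ENNReal.ofReal (Kg / (R * Real.sqrt (-t))) := by
  obtain ⟨Q, -, hSIB⟩ := scaleInvariantBounds_of_minimal hmin hW hlaw hsing
  obtain ⟨L, hL⟩ := hSIB 1
  -- the tail weight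
  set I₁ : ℝ≥0∞ := ∫⁻ η in {η : EuclideanSpace ℝ (Fin 3) | 1 ≤ ‖η‖}, ENNReal.ofReal (‖η‖ ^ (-(4 : ℝ)))
    with hI₁
  have hI₁fin : I₁ < ⊤ := lintegral_norm_rpow_neg_four_compl_ball_lt_top
  refine ⟨L ^ 2 * I₁.toReal, by positivity, fun t ht R hR => ?_⟩
  set a : ℝ := R * Real.sqrt (-t) with ha
  have hapos : 0 < a := mul_pos hR (Real.sqrt_pos.2 (neg_pos.2 ht))
  set S : Set (EuclideanSpace ℝ (Fin 3)) := {x | a ≤ ‖x‖} with hS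
  have hSm : MeasurableSet S := measurableSet_le measurable_const continuous_norm.measurable
  -- pointwise: `‖∇W(t,x)‖² ≤ L² ‖x‖⁻⁴` on `S`
  have hpt : ∀ x ∈ S, ‖fderiv ℝ (W t) x‖ₑ ^ 2 ≤ ENNReal.ofReal (L ^ 2) * ENNReal.ofReal (‖x‖ ^ (-(4 : ℝ))) := by
    intro x hx
    have hxpos : 0 < ‖x‖ := hapos.trans_le hx
    have h1 := (hL t ht x).1
    rw [norm_iteratedFDeriv_one] at h1
    have hden : 0 < (‖x‖ + Real.sqrt (-t)) ^ (1 + 1) := by positivity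
    have hL0 : 0 ≤ L := by
      by_contra hneg
      push Not at hneg
      have : L / (‖x‖ + Real.sqrt (-t)) ^ (1 + 1) < 0 := div_neg_of_neg_of_pos hneg hden
      linarith [norm_nonneg (fderiv ℝ (W t) x)]
    have h2 : ‖fderiv ℝ (W t) x‖ ≤ L / ‖x‖ ^ 2 := by
      refine h1.trans ?_
      rw [show (1 + 1 : ℕ) = 2 by norm_num]
      apply div_le_div_of_nonneg_left hL0 (by positivity)
      have := Real.sqrt_nonneg (-t)
      nlinarith
    have h3 : ‖fderiv ℝ (W t) x‖ ^ 2 ≤ L ^ 2 * ‖x‖ ^ (-(4 : ℝ)) := by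
      have h4 := pow_le_pow_left₀ (norm_nonneg _) h2 2
      rw [div_pow] at h4
      have e : L ^ 2 / (‖x‖ ^ 2) ^ 2 = L ^ 2 * ‖x‖ ^ (-(4 : ℝ)) := by
        rw [Real.rpow_neg hxpos.le, show (4 : ℝ) = ((4 : ℕ) : ℝ) by norm_num, Real.rpow_natCast,
          div_eq_mul_inv]
        ring
      rw [e] at h4; exact h4
    rw [← ENNReal.ofReal_mul (sq_nonneg _), ← ofReal_norm, ← ENNReal.ofReal_pow (norm_nonneg _)]
    exact ENNReal.ofReal_le_ofReal h3
  set i : ℝ := I₁.toReal with hi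
  have hI : I₁ = ENNReal.ofReal i := (ENNReal.ofReal_toReal hI₁fin.ne).symm
  have hi0 : 0 ≤ i := ENNReal.toReal_nonneg
  calc ∫⁻ x in S, ‖fderiv ℝ (W t) x‖ₑ ^ 2
      ≤ ∫⁻ x in S, ENNReal.ofReal (L ^ 2) * ENNReal.ofReal (‖x‖ ^ (-(4 : ℝ))) :=
        setLIntegral_mono' hSm hpt
    _ = ENNReal.ofReal (L ^ 2) * ∫⁻ x in S, ENNReal.ofReal (‖x‖ ^ (-(4 : ℝ))) :=
        lintegral_const_mul' _ _ ENNReal.ofReal_ne_top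
    _ ≤ ENNReal.ofReal (L ^ 2) * (ENNReal.ofReal a⁻¹ * I₁) :=
        mul_le_mul_of_nonneg_left (lintegral_norm_rpow_neg_four_ge_le hapos) bot_le
    _ = ENNReal.ofReal (L ^ 2 * i / (R * Real.sqrt (-t))) := by
        rw [hI, ← ENNReal.ofReal_mul (by positivity), ← ENNReal.ofReal_mul (sq_nonneg _)]
        congr 1
        rw [ha]; field_simp

/-- **If the crux fails, a critical element with the full scale-invariant package exists**
(`CriticalElement.exists_minimal_singular` + `scaleInvariantBounds_of_minimal`). [cite: KochNadirashviliSereginSverak2009, Prop. 4.1 (arXiv:0709.3599 p. 8)] -/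
theorem exists_criticalElement_scaleInvariantBounds {C K : ℝ}
    {u : ℝ → EuclideanSpace ℝ (Fin 3) → EuclideanSpace ℝ (Fin 3)} (hu : IsTypeIAncientMild C u)
    (hlaw : ∀ s : ℝ, s < 0 → ∫⁻ x, ‖fderiv ℝ (u s) x‖ₑ ^ 2 ≤ ENNReal.ofReal (K / Real.sqrt (-s)))
    (hsing : ∀ r > 0, ∀ M : ℝ, ∃ t ∈ Ioo (-(r ^ 2)) (0 : ℝ),
      ∃ x ∈ ball (0 : EuclideanSpace ℝ (Fin 3)) r, M < ‖u t x‖) :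
    ∃ Kc : ℝ, Kc ≤ K ∧ ∃ (W : ℝ → EuclideanSpace ℝ (Fin 3) → EuclideanSpace ℝ (Fin 3))
      (Q : ℝ → EuclideanSpace ℝ (Fin 3) → ℝ),
      IsTypeIAncientMild C W ∧ IsClassicalNSSolutionOn (Iio (0 : ℝ)) 1 0 W Q ∧
      RellichScarScarRigidity.ScaleInvariantBounds W Q ∧
      (∀ s : ℝ, s < 0 → ∫⁻ x, ‖fderiv ℝ (W s) x‖ₑ ^ 2 ≤ ENNReal.ofReal (Kc / Real.sqrt (-s))) ∧
      (∀ r > 0, ∀ M : ℝ, ∃ t ∈ Ioo (-(r ^ 2)) (0 : ℝ),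
        ∃ x ∈ ball (0 : EuclideanSpace ℝ (Fin 3)) r, M < ‖W t x‖) := by
  obtain ⟨Kc, hKc, ⟨W, hW, hWlaw, hWsing⟩, hmin⟩ := CriticalElement.exists_minimal_singular hu hlaw hsing
  obtain ⟨Q, hQ, hSIB⟩ := scaleInvariantBounds_of_minimal hmin hW hWlaw hWsing
  exact ⟨Kc, hKc, W, Q, hW, hQ, hSIB, hWlaw, hWsing⟩

end Summit.NavierStokesRegularity.NavierStokesRegularity.Theorems.FiniteDissipationLiouville.Envelope

end
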